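import Summits.QuantumFields.YangMills.Theorems.BalabanUVNodesN12MinimiserFamilyAtRecordBjNoPlaqGuard
import Literature.MathematicalPhysics.QuantumFieldTheory.Balaban1983to89.Node00.MultiScaleFibreChartB
import Summits.QuantumFields.YangMills.Theorems.BalabanUVNodesN12ClassLetterGeometryOfRecordB
import HarnessLib

/-!
# BalabanUVNodes ∕ N12 — THE (J0′) PRODUCER OF RECORD AT `𝐁_k(Z)` WITH dag-n12-w3's PLAQUETTE-GUARD ROW `t₀` AND THE SURJECTIVITY ROW `hsurj` BOTH GONE — **BOND-DATUM EDITION** (`…N12MinimiserFamilyAtRecordBjNoPlaqGuardB`, USED DECLARATIONS ONLY)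

The print-datum ([Balaban1984PropagatorsII] (2.3)) (γ) twin of `Summits/…/Theorems/BalabanUVNodesN12MinimiserFamilyAtRecordBjNoPlaqGuard.lean`: the declarations of the parent whose STATEMENT reads the determining datum
(`fderiv_msChart_apply_eq_suProj_qLin_of_smallBelow`) and which N12's junction of record v14ᴸ uses (dag-n12-c g35 probe-2 census `UsedConstsN12RoadTyped2`, THEOREMS block), re-typed over a
BOND-LEVEL datum `𝔅 : BDetSet` (F0a `B15DeterminingSetsB`) and dag-n12-c's bond-datum chart `Node00.msChartB` (✓p774329; `msChart 𝐁 = msChartB (bondsDet 𝐁)` by `rfl`).  GENERATOR twin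
(this seat's `work/g32/gen_thm.py`, block-extracted from the parent's tree bytes): namespace `…N12MinimiserFamilyAtRecordBjNoPlaqGuardB`, SAME short names, `DetSet ↦ BDetSet`, `AgreeOn 𝐁 ↦ AgreeOnB 𝔅`,
`IsMinimizer ↦ IsMinimizerB`, `bondsOf (𝐁 j) ↦ 𝔅 j`, `msChart ∕ constrCard ∕ constrEnum ∕ ConstrSet ↦ …B`, NODE 00 chart lemmas `…msChart… ↦ …msChartB…`; proofs VERBATIM; the parent's
datum-free declarations REUSED BY NAME (`open`), never copied (private plumbing excepted, №366 R2).  The parent's (b) statements are the instances `𝔅 := bondsDet 𝐁`.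

Cell `pub-ymgap` (HUMAN RULINGS D-0062 ∕ D-0149), seat `pub-ymgap-dag-n12-d` g32 (R134 N12 [B15] s2; the (ii) Theorems-side re-key of N12's road at print's [II] (2.3) datum — director-ym №338 ∕
№343 (E1)(iii-b), FLAG №16 ∕ ruling (α); dag-n12-c DESIGN memo a793b2ebc0b803bf (ii); `N12-ROAD-TWIN-ORDER-2026-08-30.md`).  Count-neutral helper of K1⁹ `stmt-QuantumFields-27364`,
`--kind proof --supports … --as helper`.  THEOREMS ONLY (0 `def`, 0 `instance`, 0 `sorry`).

HONEST FRAMING (director-ym №338 (5)).  PURELY ADDITIVE: the parent stays landed and true on its own text; nothing in it is edited; no displayed premise of any consumer is deleted or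
weakened; every hypothesis of the parent stays a hypothesis.  Nothing of Bałaban's analysis asserted; N12 NOT discharged; K0⁷ ∕ K1⁹ NOT closed; counts unmoved (typed 28∕28 · discharged
8∕27, A 8∕28; K 1∕4); one finite 𝕋⁴ programme at fixed ε — R4 closes the conditional rung `BalabanLadder.UV` only; NOT the Yang–Mills mass gap (Clay); nothing continuum ∕ ℝ⁴ ∕ OS.

PARENT's DOCSTRING (the mathematics and the citations; read the site-level `𝐁` as the bond datum `𝔅`):
# BalabanUVNodes ∕ N12 — THE (J0′) PRODUCER OF RECORD AT `𝐁_k(Z)` WITH dag-n12-w3's PLAQUETTE-GUARD ROW `t₀` AND THE SURJECTIVITY ROW `hsurj` BOTH GONE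
# ([Balaban1985Variational] Thm 1 p. 279, (4) p. 278, (16)–(18) p. 280, Sect. C (44)–(48) p. 285, (82)–(83) p. 290; [Balaban1985Averaging] (11) p. 19; [Balaban1988Convergent] (2.2) p. 255,
# (2.10)–(2.13) pp. 256–257; [Balaban1989LargeFieldI] (1.74) p. 192, Prop. 1 p. 194)

Cell `pub-ymgap` (HUMAN RULINGS D-0062 ∕ D-0149), WIDTH SEAT `pub-ymgap-dag-n12-w6` g11 (node N12 = [B15]; key K1⁹ `stmt-QuantumFields-27364`, `--kind proof --supports … --as helper`;
count-neutral).  THEOREMS ONLY (0 `def`, 0 `instance`, 0 `sorry`); by name over this lineage's g11 `N12ForestSliceOfProxies` ∕ `N12HsurjOfClass` (p705019), dag-n12-w3's `N12ForestSliceLeftField` ∕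
`N12ForestSlice`, dag-n10-w1's `N12GuardedLinAvgRightInverseLeft.dIterL_leftField_eq_of_suProj_qLin_eq`, dag-n12-w1's `B15Prop1RightInverseFromForestLeftField.hR_of_forest_leftField`,
`B15Prop1MinimiserFamilyFromThm1AtBaseCentral.hMin_atRecord_of_node00Letters_thm1AtBase_central`, `N12ClassLetterGeometryOfRecord.classLetters_closure_regMSCoPOfRecord_Bj`, NODE 00's
`fderiv_msChart_apply_of_hasDerivAt` ∕ `hasDerivAt_coeField_iter_expChart_smul` ∕ `coeField_avgFamily_eq_iterM`.

WHY (LOCATED-HSURJ rows (i)+(ii), this seat, bus 2026-08-29 06:49Z).  dag-n12-w1 g4's (J0′) producer `N12MinimiserFamilyAtRecordBj.hMin_atRecord_Bj_of_printLetters` displays per base field,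
besides the two (0.4) guards `hsbQ`∕`hsbU` (plan g91 LOCATED-E1-HSB, repair (r1)–(r3)), two more rows with no large-field producer: (i) `hsurj` (removed by `N12HsurjOfClass`, from the class)
and (ii) dag-n12-w3's plaquette guards `∃ t₀, 0 < t₀ ∧ stokesConst·t₀ < δ_2 ∧ ∀ i < k, PlaqSmall t₀ (Ū^i U₀)` — every plaquette of every iterated average of `U₀`.  Row (ii) is IDLE given
the displayed `hsbU : SmallBelow k U₀`: it was used only through `smallBelow_of_plaqSmall` and dag-n10-w1's `t₀`-phrased junction `fderiv_msChart_apply_eq_suProj_qLin`, whose `SmallBelow`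
edition is NODE 00's velocity formula (§1).  THIS FILE re-threads dag-n12-w3's left-field letter and dag-n12-w1 g3∕g4's two knit links on `SmallBelow k U₀` alone and feeds `hsurj` from the
class: per base field the producer now displays EXACTLY (E) the minimiser, `hsbQ`, `hsbU`, (β), (T1@q₀) — the (r3) targets and N07∕K0 letters, nothing else.

CONTENTS.  §1 ★ `fderiv_msChart_apply_eq_suProj_qLin_of_smallBelow` (dag-n10-w1's junction, `SmallBelow` only).  §2 ★★ `exists_forest_leftField_of_smallBelow_of_agreeOn` (dag-n12-w3's
`exists_forest_leftField_of_surjective_curved_of_agreeOn`, `t₀` ↦ `SmallBelow k U₀`; via `N12ForestSliceOfProxies.exists_forest_preimage_of_surjective_proxies` with `U₀` its own proxy).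
§3 ★★ `hR_forest_of_surjective_smallBelow` (dag-n12-w1 g3's `hR_forest_of_surjective_curved`, `t₀` ↦ `SmallBelow`).  §4 ★★★ `hMin_atRecord_of_node00Letters_thm1AtBase_central_surj_smallBelow`
(dag-n12-w1 g3's `…_central_surj` with the `t₀` conjunct of `hbase` DROPPED).  §5 ★★★ `hMin_atRecord_Bj_of_printLetters_ofClass` (dag-n12-w1 g4's producer at `kc := k` with BOTH the `t₀`
and the `hsurj` conjuncts DROPPED; rows added once per instance: `N12HsurjOfClass`'s per-height letters `hsbU′`∕`hHB` + floors, `k + 1 ≤ m + K`).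

HONEST FRAMING.  Bookkeeping by name; `hsbQ`∕`hsbU` REMAIN displayed ((0.4)-regime rows until (r3)); per-height EXISTENCE letters; nothing of Bałaban's estimates asserted or refuted; N12 NOT
discharged; K1⁹ NOT closed; counts of record unmoved; one finite 𝕋⁴ programme at fixed ε — R4 closes only the conditional rung `BalabanLadder.UV`; no summit statement is proved here and
NOT the Yang–Mills mass gap (Clay); nothing continuum ∕ ℝ⁴ ∕ OS.
-/

noncomputable section

namespace Summit.QuantumFields.YangMills.BalabanUVNodes.N12MinimiserFamilyAtRecordBjNoPlaqGuardB

open Literature.MathematicalPhysics.QuantumFieldTheory.Balaban1983to89.B15DeterminingSetsB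

open scoped BigOperators Matrix.Norms.L2Operator Topology
open Filter
open Literature.MathematicalPhysics.QuantumFieldTheory.Balaban1983to89
open T4Continuum
open B15DeterminingSets GaugeField
open BlockAveraging (blockAvg)
open ExpMeanLog (expMeanLogSU deltaSU)
open T4AdjointCovarianceUnitary (lieSU expSU specialUnitaryAd coe_specialUnitaryAd)
open Node00
open B15SU2ChartHolomorphic (genE)
open B15Prop1AnalyticExtClause (cplxVec)
open B15Prop1ChartCalculusSU2 (E3)
open T4CubeChartGnomonic (SU2)
open B14.Eq213DetSet (Bj maxDomT Bj_of_gt)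
open B14.Eq213MaximalDomains (side)
open B14.Eq216Concrete (feeds)
open B5Eq118OneStroke (iterBlockOf)
open B15Eq112TorusCover (lift)
open T4AxialGaugeSmallField (boxPlaqs)
open T4ReflectionCone (three_le_L)
open Summit.QuantumFields.YangMills.Theorems.BlockAvgCorrector (stokesConst)
open Summit.QuantumFields.YangMills.BalabanUVNodes.N12ForestSliceOfProxies (exists_forest_preimage_of_surjective_proxies)
open Summit.QuantumFields.YangMills.BalabanUVNodes.N12HsurjOfClass (surjective_fderiv_msChart_Bj_of_isMinimizer_class)
open Summit.QuantumFields.YangMills.BalabanUVNodes.N12GuardedLinAvgRightInverseLeft (dIterL_leftField_eq_of_suProj_qLin_eq)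
open Summit.QuantumFields.YangMills.BalabanUVNodes.N12ClassLetterGeometryOfRecordB (classLetters_closure_regMSCoPOfRecord_lamBondsSeq)
open Summit.QuantumFields.YangMills.BalabanUVNodes.N12ForestSlice (exists_forest_slice_Bj)
open Literature.MathematicalPhysics.QuantumFieldTheory.Balaban1983to89.B15Prop1RightInverseFromForestLeftField (hR_of_forest_leftField)
open Literature.MathematicalPhysics.QuantumFieldTheory.Balaban1983to89.B15Prop1MinimiserFamilyFromThm1AtBaseCentral (hMin_atRecord_of_node00Letters_thm1AtBase_central)
open Literature.MathematicalPhysics.QuantumFieldTheory.BalabanImbrieJaffe1984to88.BIJ85Eq453GaugeField (qsstarGIter0)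
open B15AveragingHolomorphic (iterMh)
open B15SU2ChartHolomorphic (expMulC logCoordC)
open B15ShellGauge193 (shellGauge)
open B15Extension193 (extend)
open B16Sect1Backgrounds (toMS expMul)
open B15Prop1ChartSU2 (su2Chart)
open Metric (ball)

section
variable {F : T4Family} {N : ℕ} [NeZero N] {K k : ℕ}

/-- ★ **`(DΦ_U(0)X)_i = π(qLin j U X c)` FROM THE (0.4) GUARDS ALONE** — dag-n10-w1's `N12GuardedChartDerivQLinJunction.fderiv_msChart_apply_eq_suProj_qLin` with the plaquette guard
«`∀ i < k, PlaqSmall t₀ (Ū^i U)`, `stokesConst·t₀ < δ_N`» REPLACED by `SmallBelow … k U`: NODE 00's velocity formula `fderiv_msChartB_apply_of_hasDerivAt` fed by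
`hasDerivAt_coeField_iter_expChart_smul` and `coeField_avgFamily_eq_iterM`. [cite: Balaban1985Variational, (44)–(48) p.285, (83) p.290; Balaban1987RG1, (0.4) p.253, (0.21) p.256] -/
theorem fderiv_msChart_apply_eq_suProj_qLin_of_smallBelow {U : GaugeField (F.P K) 0 (SU N)} (hsb : SmallBelow (avOfRecord F N K) k U)
    (𝔅 : BDetSet (F.P K)) (X : PBond (F.P K) 0 → lieSU (Fin N)) (i : Fin (constrCardB 𝔅 k)) :
    fderiv ℝ (msChartB F N K k 𝔅 (avgFamily (avOfRecord F N K) U) U) 0 X i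
      = suProj N (qLin (((constrEnumB 𝔅 k).symm i).1 : ℕ) U X ((constrEnumB 𝔅 k).symm i).2.1) := by
  set s := (constrEnumB 𝔅 k).symm i with hs
  have hj : (s.1 : ℕ) ≤ k := Nat.lt_succ_iff.1 s.1.2
  have hsbj : SmallBelow (fun i => blockAvg (P := F.P K) (j := i) (expMeanLogSU (n := Fin N))) (s.1 : ℕ) U := hsb.mono hj
  have hvelc : HasDerivAt (fun t : ℝ => ((avgFamily (avOfRecord F N K) (expChart U (t • X)) s.1 s.2.1 : SU N) : Matrix (Fin N) (Fin N) ℂ))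
      (dIterL (s.1 : ℕ) (coeField U) (fun b => (U b : Matrix (Fin N) (Fin N) ℂ) * (X b : Matrix (Fin N) (Fin N) ℂ)) s.2.1) 0 :=
    (hasDerivAt_pi.1 (hasDerivAt_coeField_iter_expChart_smul hsbj X)) s.2.1
  have hWeq : ((avgFamily (avOfRecord F N K) U s.1 s.2.1 : SU N) : Matrix (Fin N) (Fin N) ℂ)
      = (iterM (s.1 : ℕ) : (PBond (F.P K) 0 → Matrix (Fin N) (Fin N) ℂ) → PBond (F.P K) s.1 → Matrix (Fin N) (Fin N) ℂ) (coeField U) s.2.1 := by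
    have h := congrFun (coeField_avgFamily_eq_iterM (k := (s.1 : ℕ)) hsbj) s.2.1
    rw [coeField_apply] at h
    exact h
  rw [fderiv_msChartB_apply_of_hasDerivAt (fun _ _ _ => rfl) hsb X i hvelc, qLin_apply, ← hWeq]

end

end Summit.QuantumFields.YangMills.BalabanUVNodes.N12MinimiserFamilyAtRecordBjNoPlaqGuardB

end
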